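/-
Copyright: lit-balaban Phase-2 proof seat p30 (gen 6).  Statement-level skeleton of a published paper; no proof claims beyond what
the kernel checks below.
-/
import Literature.MathematicalPhysics.QuantumFieldTheory.BalabanImbrieJaffe1984to88.BIJ85Eq625Torus

/-!
# `BalabanImbrieJaffe1984to88.BIJ85Sigma320Torus` — T. Bałaban, J. Imbrie, A. Jaffe, *Renormalization of the Higgs model: minimizers,
propagators and the stability of mean field theory*, Commun. Math. Phys. **97** (1985) 299–329 [BalabanImbrieJaffe1985]: Sect. 3,
**(3.17)–(3.20) AT THE TORUS MODEL INSTANCE — the first step `k = 1` of (4.2.2)** (*"For example, if k = 1, then G_{k,Ax} = C and (4.2.2)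
agrees with (3.21) [= (3.20)]"*, p. 311): on the tori, `H_{0,Ax} = I`, `G_{1,Ax} = C` = the propagator of `½‖∂A‖²` on the constraint space
`ℋ₀ = δ(QA)δ_{Ax}(A)` of (3.15), `σ₁ = Q^e(I − ∂C∂^*)Q^{e*}` ((3.20)), `⟨B, (I − P)B⟩ = ⟨F, ΣF⟩` with `Σ = L^{−d}Q^e(I − P)Q^{e*}`, `P = ∂C∂^*`
((3.17)–(3.18)) and *"scaling to the unit lattice absorbs the factor L^{−d}: S_L⟨F, ΣF⟩ = ⟨f^{(1)}, σ₁f^{(1)}⟩. (3.19)"* — all from the general-k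
torus calculus of seats p09/p11/p30 (`BIJ85Eq625Torus.axialPropagator_eq_GaxE` at `k = 1`, `BIJ85SigmaTorusScaling.scaling_absorbs` at `k + 1 = 1`)

statement-level skeleton of published theorems with citation tags; proofs where landed; nothing here is a claim about the Yang–Mills mass gap

PDF held: `paper:balaban1985-cmp97-bij-higgs-minimizers` (journal page = PDF page + 298).  Pages read as images: pp. 307–308, 311
[PDF 9–10, 13] (`HOME/lit-balaban-r15/pages/1985-cmp97-bij-higgs-minimizers-p009,p010,p013-x2.png`).

CITATION HEADER (lean-in-tree rule).  Part of the lit-balaban TYPED SKELETON (HOME `run/shared/lean/pub/lit-balaban/`), Phase-2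
seat p30 (gen 6), unit `lit-balaban-p30`; WHAT IS REPRODUCED = rows **C1.Eq3.19-3.21** (members (3.19), (3.20)), **C1.Eq3.17-3.18** and
**C1.Eq3.15-3.16** (the covariance `C`) of `HOME/SKELETON.md` (reader file `HOME/lit-balaban-r15/ROWS-C1.md`) AT THE TORUS MODEL OF RECORD
(kind «model-instance»); abstract versions: seat p30's `BIJ85Eq317Proof` (Prop. A1 / Cor. A2 instances).

THE PRINTED TEXT (verbatim).  p. 307 [PDF 9]: *"the fluctuation field A′ = A + A_cl (3.16) has a Gaussian distribution with mean zero and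
covariance C. Furthermore, by Corollary A2, ½‖∂A + B‖² = ½⟨A′, C^{−1}A′⟩ + ½⟨B, (I − P)B⟩, (3.17) where P = ∂C∂^* is the orthogonal
projection onto the range of ∂. Note that if we define Σ = L^{−d}Q^e(I − P)Q^{e*}, then ⟨B, (I − P)B⟩ = ⟨F, ΣF⟩. (3.18)"*; p. 307–308: *"In
(3.18), the scaling to the unit lattice absorbs the factor L^{−d}, namely S_L⟨F, ΣF⟩ = ⟨f^{(1)}, σ₁f^{(1)}⟩. (3.19) Here σ₁ = Q^e(I −
∂C∂^*)Q^{e*}, f^{(1)}(p) = (ie(Lε))^{−1} ln v(p). (3.20)"*; p. 311 [PDF 13]: *"For example, if k = 1, then G_{k,Ax} = C and (4.2.2) agrees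
with (3.21)."*

THE TORUS DATA (as in `BIJ85Eq625Torus`): η-bond fields `BondSpace P` (= `CoarseSpace P 0`: at `k = 0` the unit lattice IS the fine
lattice), η-plaquette fields `PlaqSpace P`, `∂ = curlOp w c`, `∂^* = LinearMap.adjoint (curlOp w c)`, L-lattice plaquette fields `UnitPlaqSpace P
1` (the `F`, resp. `f^{(1)}` after rescaling — rescaling is the identity on these types, the weight `w` carries it), `Q^{e*} = QesOp hd w 1`,
`σ₁ = sigmaTorus hd w c 1` ((4.2.1)–(4.2.2) at `k = 1`), `ℋ₀ = Wstep P 0` = δ(QA)δ_{Ax}(A), `C = axialPropagator (Wstep P 0) ∂` (p09's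
(4.1.1)-type operator on `ℋ₀`), `P = ∂C∂^*`, `B = l·Q^{e*}F`, `l = L^{−d/2}`, `Σ = l²·σ₁`.

WHAT IS PROVED: §1 `QsE_zero` (`Q^{s*}_0 = I`), `HaxE_zero` (`H_{0,Ax} = I`), `CE_zero` (`C^{(0)} = C`), **`GaxE_one`** / **`axialPropagator_one`**
(*"if k = 1, then G_{k,Ax} = C"*); §2 **`sigma_one_eq`** ((3.20) `σ₁ = Q^e(I − ∂C∂^*)Q^{e*}` for the torus σ₁ of (4.2.1)); §3 **`eq318_torus`**
((3.17)–(3.18): `⟨B, (I − P)B⟩ = ⟨F, ΣF⟩`, `B = lQ^{e*}F`, `Σ = l²σ₁`), `P_idem` (P is a projection); §4 **`eq319_torus`** ((3.19): `⟨F, ΣF⟩` in the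
weight `w` = `⟨F, σ₁F⟩` in the rescaled weight `l²w`, any curl factor).  Standing range `1 ≤ m + K`; `c ≠ 0`, `w > 0`, `2 ≤ d`.  D-0026: theorems
only, no `def`, no new named fact.  Unit `lit-balaban-p30` (literature-prover-lit-balaban-p30-g6-0), 2026-08-21.
-/

open scoped BigOperators RealInnerProductSpace

namespace Literature.MathematicalPhysics.QuantumFieldTheory.BalabanImbrieJaffe1984to88.BIJ85Sigma320Torus

open Literature.MathematicalPhysics.QuantumFieldTheory.Balaban1983to89
open LatticeFieldCalculus BIJ85AxialPropagator411 BIJ85SigmaForm421 BIJ85UnitPropagator433 BIJ85Prop521Proof BIJ85Prop521Torus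
  BIJ85Sigma421Torus BIJ85Eq611Torus BIJ85Prop522Torus BIJ85Eq531Inputs BIJ85SigmaTorusScaling BIJ85Eq625Torus

noncomputable section

variable {P : Params}

/-! ## 1. `k = 0`: `Q^{s*}_0 = I`, `H_{0,Ax} = I`, `C^{(0)} = C`, hence `G_{1,Ax} = C` -/

/-- `Q^{s*}_0 = I` (no averaging yet: the unit lattice of step 0 is the fine lattice). [cite: BalabanImbrieJaffe1985, (2.17) p.304] -/
theorem QsE_zero : QsE P 0 = LinearMap.id := by
  refine LinearMap.ext fun B => ?_
  rw [QsE_apply, QsstarIter_zero]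
  rfl

/-- `H_{0,Ax} = I`: with no constraint (`V411 P 0 = ⊥`, `G_{0,Ax} = 0`) the minimizer of the class of `A` is `A` itself.
[cite: BalabanImbrieJaffe1985, (4.1.3) p.310] -/
theorem HaxE_zero (w c : ℝ) : HaxE P w c 0 = LinearMap.id := by
  rw [HaxE, HaxOp, V411_zero, axialPropagator_bot, LinearMap.zero_comp, sub_zero, QsE_zero]

/-- **`C^{(0)} = C`**: the propagator (4.3.3) of step 0 is the covariance `C` of (3.15)–(3.17) — the (4.1.1)-type propagator of `½‖∂A‖²` on
the constraint space `ℋ₀ = δ(QA)δ_{Ax}(A)` (`Wstep P 0`). [cite: BalabanImbrieJaffe1985, (3.17) p.307] -/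
theorem CE_zero (w c : ℝ) : CE P w c 0 = axialPropagator (Wstep P 0) (curlOp (P := P) w c) := by
  rw [CE, HaxE_zero, LinearMap.comp_id]

/-- **"if k = 1, then G_{k,Ax} = C"** (p. 311) for the sum (5.2.2): `G_{1,Ax} = H_{0,Ax}C^{(0)}H^*_{0,Ax} = C`.
[cite: BalabanImbrieJaffe1985, (4.2.2) p.311] -/
theorem GaxE_one (w c : ℝ) : GaxE P w c 1 = axialPropagator (Wstep P 0) (curlOp (P := P) w c) := by
  rw [GaxE, Finset.sum_range_one, HaxE_zero, CE_zero, LinearMap.adjoint_id, LinearMap.comp_id, LinearMap.id_comp]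

/-- **"if k = 1, then G_{k,Ax} = C"** (p. 311) for the functional-integral propagator (4.1.1) at `k = 1` on the tori (`1 ≤ m + K`, `c ≠ 0`,
`w > 0`; `BIJ85Eq625Torus.axialPropagator_eq_GaxE`). [cite: BalabanImbrieJaffe1985, (4.2.2) p.311] -/
theorem axialPropagator_one (h1 : 1 ≤ P.m + P.K) {c : ℝ} (hc : c ≠ 0) {w : ℝ} (hw : 0 < w) :
    axialPropagator (V411 P 1) (curlOp (P := P) w c) = axialPropagator (Wstep P 0) (curlOp (P := P) w c) := by
  rw [axialPropagator_eq_GaxE hc hw h1, GaxE_one]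

/-! ## 2. (3.20): `σ₁ = Q^e(I − ∂C∂^*)Q^{e*}` -/

/-- **(3.20) ON THE TORI** p. 308 [PDF 10], verbatim: *"Here σ₁ = Q^e(I − ∂C∂^*)Q^{e*}"* — the torus σ₁ of (4.2.1)–(4.2.2) (`sigmaTorus hd w c 1`,
seat p30 gen 3; it satisfies the Gaussian identity (4.2.1), `isSigmaForm_sigmaTorus`) IS `Q^e(I − ∂C∂^*)Q^{e*}` with `C` the covariance of
(3.15)–(3.17) (`axialPropagator (Wstep P 0) ∂`), `Q^e` = the adjoint of `Q^{e*} = QesOp hd w 1`; `1 ≤ m + K`, `c ≠ 0`, `w > 0`.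
[cite: BalabanImbrieJaffe1985, (3.20) p.308] -/
theorem sigma_one_eq (hd : 2 ≤ P.d) (h1 : 1 ≤ P.m + P.K) {c : ℝ} (hc : c ≠ 0) {w : ℝ} (hw : 0 < w) :
    sigmaTorus (P := P) hd w c 1 =
      LinearMap.adjoint (QesOp (P := P) hd w 1)
        ∘ₗ (LinearMap.id - curlOp (P := P) w c ∘ₗ axialPropagator (Wstep P 0) (curlOp (P := P) w c)
              ∘ₗ LinearMap.adjoint (curlOp (P := P) w c))
        ∘ₗ QesOp (P := P) hd w 1 := by
  rw [sigmaTorus, sigmaOp, curlG, axialPropagator_one h1 hc hw]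

/-! ## 3. (3.17)–(3.18): `P = ∂C∂^*` is a projection and `⟨B, (I − P)B⟩ = ⟨F, ΣF⟩` -/

/-- **(3.17)** p. 307: *"P = ∂C∂^* is the orthogonal projection onto the range of ∂"* — on the tori `P` (= p09's `curlG` at `k = 1`, by
`axialPropagator_one`) is idempotent (p09's `curlG_idem`, no zero modes p11's `hD_V411`); `1 ≤ m + K`, `c ≠ 0`, `w > 0`.
[cite: BalabanImbrieJaffe1985, (3.17) p.307] -/
theorem P_idem (h1 : 1 ≤ P.m + P.K) {c : ℝ} (hc : c ≠ 0) {w : ℝ} (hw : 0 < w) (g : PlaqSpace P) :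
    curlOp (P := P) w c (axialPropagator (Wstep P 0) (curlOp (P := P) w c) (LinearMap.adjoint (curlOp (P := P) w c)
        (curlOp (P := P) w c (axialPropagator (Wstep P 0) (curlOp (P := P) w c) (LinearMap.adjoint (curlOp (P := P) w c) g))))) =
      curlOp (P := P) w c (axialPropagator (Wstep P 0) (curlOp (P := P) w c) (LinearMap.adjoint (curlOp (P := P) w c) g)) := by
  have h := curlG_idem (hD_V411 h1 hc hw) g
  simp only [curlG, LinearMap.comp_apply, axialPropagator_one h1 hc hw] at h
  exact h

/-- **(3.17)–(3.18) ON THE TORI** p. 307 [PDF 9], verbatim: *"Note that if we define Σ = L^{−d}Q^e(I − P)Q^{e*}, then ⟨B, (I − P)B⟩ = ⟨F, ΣF⟩.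
(3.18)"* — with `B = L^{−d/2}Q^{e*}F` ((3.13)/(3.15): `l • QesOp hd w 1 F`, `l = L^{−d/2}`), `P = ∂C∂^*`, `Σ = l²·σ₁` (by `sigma_one_eq`, `Σ =
L^{−d}Q^e(I − ∂C∂^*)Q^{e*}` verbatim); `1 ≤ m + K`, `c ≠ 0`, `w > 0`. [cite: BalabanImbrieJaffe1985, (3.18) p.307] -/
theorem eq318_torus (hd : 2 ≤ P.d) (h1 : 1 ≤ P.m + P.K) {c : ℝ} (hc : c ≠ 0) {w : ℝ} (hw : 0 < w) (l : ℝ)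
    (F : UnitPlaqSpace P 1) :
    ⟪l • QesOp (P := P) hd w 1 F,
      l • QesOp (P := P) hd w 1 F - curlOp (P := P) w c (axialPropagator (Wstep P 0) (curlOp (P := P) w c)
        (LinearMap.adjoint (curlOp (P := P) w c) (l • QesOp (P := P) hd w 1 F)))⟫ =
      ⟪F, (l ^ 2 • sigmaTorus (P := P) hd w c 1) F⟫ := by
  rw [sigma_one_eq hd h1 hc hw, LinearMap.smul_apply, real_inner_smul_right, LinearMap.comp_apply, LinearMap.comp_apply,
    LinearMap.adjoint_inner_right]
  simp only [LinearMap.sub_apply, LinearMap.id_apply, LinearMap.comp_apply, map_smul, inner_smul_left, RCLike.conj_to_real]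
  rw [← smul_sub, real_inner_smul_right]
  ring

/-! ## 4. (3.19): the scaling to the unit lattice absorbs `L^{−d}` -/

/-- **(3.19) ON THE TORI** p. 307–308 [PDF 9–10], verbatim: *"In (3.18), the scaling to the unit lattice absorbs the factor L^{−d}, namely
S_L⟨F, ΣF⟩ = ⟨f^{(1)}, σ₁f^{(1)}⟩. (3.19)"* — `Σ = l²σ₁` in the weight `w` of the ε-lattice step equals `σ₁` in the rescaled weight `l²w` (rescaling
is the identity on the torus types, `Setup` F7; the torus σ is linear in the weight and independent of the curl factor, seat p30's
`BIJ85SigmaTorusScaling.scaling_absorbs` at `k + 1 = 1`): `⟨F, (l²σ₁^{(w,c)})F⟩ = ⟨F, σ₁^{(l²w,c′)}F⟩`; `1 ≤ m + K`, `c, c′, l ≠ 0`, `w > 0`.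
[cite: BalabanImbrieJaffe1985, (3.19) p.308] -/
theorem eq319_torus (hd : 2 ≤ P.d) (h1 : 1 ≤ P.m + P.K) {c c' : ℝ} (hc : c ≠ 0) (hc' : c' ≠ 0) {w : ℝ} (hw : 0 < w) {l : ℝ}
    (hl : l ≠ 0) (F : UnitPlaqSpace P 1) :
    ⟪F, (l ^ 2 • sigmaTorus (P := P) hd w c 1) F⟫ = ⟪F, sigmaTorus (P := P) hd (l ^ 2 * w) c' 1 F⟫ := by
  rw [LinearMap.smul_apply, real_inner_smul_right]
  exact scaling_absorbs hd (k := 0) h1 hw hc hc' hl F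

/-- **(3.18) + (3.19) combined**: `⟨B, (I − P)B⟩` (ε-lattice weight `w`, `B = lQ^{e*}F`) `= ⟨f^{(1)}, σ₁f^{(1)}⟩` (unit-lattice weight `l²w`), with the
printed `l = L^{−d/2}`, `l² = L^{−d}`. [cite: BalabanImbrieJaffe1985, (3.19) p.308] -/
theorem eq318_319_torus (hd : 2 ≤ P.d) (h1 : 1 ≤ P.m + P.K) {c c' : ℝ} (hc : c ≠ 0) (hc' : c' ≠ 0) {w : ℝ} (hw : 0 < w)
    (F : UnitPlaqSpace P 1) :
    let l : ℝ := (Real.sqrt (P.L : ℝ))⁻¹ ^ P.d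
    ⟪l • QesOp (P := P) hd w 1 F,
      l • QesOp (P := P) hd w 1 F - curlOp (P := P) w c (axialPropagator (Wstep P 0) (curlOp (P := P) w c)
        (LinearMap.adjoint (curlOp (P := P) w c) (l • QesOp (P := P) hd w 1 F)))⟫ =
      ⟪F, sigmaTorus (P := P) hd (((P.L : ℝ) ^ P.d)⁻¹ * w) c' 1 F⟫ := by
  intro l
  have hL : (0 : ℝ) < (P.L : ℝ) := by have := P.hL.2; positivity
  have hl0 : l ≠ 0 := pow_ne_zero _ (inv_ne_zero (Real.sqrt_pos.2 hL).ne')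
  have hl : l ^ 2 = ((P.L : ℝ) ^ P.d)⁻¹ := by
    show ((Real.sqrt (P.L : ℝ))⁻¹ ^ P.d) ^ 2 = _
    rw [← pow_mul, mul_comm, pow_mul, inv_pow, Real.sq_sqrt hL.le, inv_pow]
  rw [eq318_torus hd h1 hc hw l F, eq319_torus hd h1 hc hc' hw hl0 F, hl]

end

end Literature.MathematicalPhysics.QuantumFieldTheory.BalabanImbrieJaffe1984to88.BIJ85Sigma320Torus
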